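import Literature.NumberTheory.Sieve.FordMaynardFragmentation

/-!
# Route `FordMaynardNoSieveConst0164`, crux `NegWitness0164` (stmt-Parity-19102), line `birth`,
# stub `stub_tweakNeg0164`: the Linnik weight of a two-piece fragmentation

Second helper file toward the certificate stub (K. Ford, J. Maynard, *On the theory of prime producing
sieves*, arXiv:2407.14368, §8, proof of Theorem 2.7 (c): "Using (Linnik-fcn), if `k = 2` then
`𝓛_{1/2}(u) = -1`").  For a block `u = (u₀, u₁)` with both pieces `< c` and `u₀ + u₁ ≥ c` the Linnik
function is `𝓛_c(u) = N(u) - N⋆N(u)/2 = 0 - 2/2 = -1`; hence the weight of a two-piece fragmentation of a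
component `α ≥ 1 - γ` into pieces `< 1 - γ` in the fragmentation operator (6.3) is
`blockWeight γ 2 u = -1/(2 u₀ u₁)`.  This is the coefficient of every "α ↦ two pieces" term of the
certificate (the `F₃(α)`, `F₄(α) = log(α/max(ν, α - 1/2) - 1)` terms of §8 and of `CERT-FORMAT.md` §1,
`Lam(c₁c₂; t) = -D2`).  Def-free.

* `sconv_univ_fin_two` — `(F ⋆ G)(univ) = F ∅ G univ + F {0} G {1} + F {1} G {0} + F univ G ∅` on `Fin 2`;
* `linnikFn_two_eq_neg_one` — `𝓛_c(u₀, u₁) = -1` for `u₀, u₁ < c ≤ u₀ + u₁`;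
* `blockWeight_two_eq` — `blockWeight γ 2 u = -1 / (2 u₀ u₁)` for `u₀, u₁ < 1 - γ ≤ u₀ + u₁`.

References: [FordMaynard2024PrimeSieves] arXiv:2407.14368, (Linnik-fcn) §5.1, Lemma 5.5, §8.
-/

noncomputable section

open Finset
open Literature.Combinatorics.Enumerative
open Literature.NumberTheory.Sieve Literature.NumberTheory.Sieve.FordMaynard

namespace Summit.Parity.GeneralizedHardyLittlewood.FordMaynardNoSieveConst0164NegWitness0164

/-- The power set of `univ : Finset (Fin 2)`. [folklore] -/
theorem powerset_univ_fin_two :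
    (Finset.univ : Finset (Fin 2)).powerset = {∅, {0}, {1}, Finset.univ} := by
  decide

/-- Disjoint-union convolution on `Fin 2`, expanded:
`(F ⋆ G)(univ) = F ∅ G univ + F {0} G {1} + F {1} G {0} + F univ G ∅`. [folklore] -/
theorem sconv_univ_fin_two (F G : Finset (Fin 2) → ℝ) :
    sconv F G Finset.univ =
      F ∅ * G Finset.univ + F {0} * G {1} + F {1} * G {0} + F Finset.univ * G ∅ := by
  unfold sconv
  rw [powerset_univ_fin_two]
  have h1 : (∅ : Finset (Fin 2)) ∉ ({{0}, {1}, Finset.univ} : Finset (Finset (Fin 2))) := by decide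
  have h2 : ({0} : Finset (Fin 2)) ∉ ({{1}, Finset.univ} : Finset (Finset (Fin 2))) := by decide
  have h3 : ({1} : Finset (Fin 2)) ∉ ({Finset.univ} : Finset (Finset (Fin 2))) := by decide
  rw [Finset.sum_insert h1, Finset.sum_insert h2, Finset.sum_insert h3, Finset.sum_singleton]
  have e1 : (Finset.univ : Finset (Fin 2)) \ ∅ = Finset.univ := by decide
  have e2 : (Finset.univ : Finset (Fin 2)) \ {0} = {1} := by decide
  have e3 : (Finset.univ : Finset (Fin 2)) \ {1} = {0} := by decide
  have e4 : (Finset.univ : Finset (Fin 2)) \ Finset.univ = ∅ := by decide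
  rw [e1, e2, e3, e4]
  ring

/-- **`𝓛_c(u₀, u₁) = -1`** for a two-piece block with both pieces `< c` and `u₀ + u₁ ≥ c`:
`𝓛 = N(univ) - (N ⋆ N)(univ)/2` with `N(univ) = 0` and `(N ⋆ N)(univ) = N{0}N{1} + N{1}N{0} = 2`.
[cite: FordMaynard2024PrimeSieves, §8 (proof of Theorem 2.7 (c), "if k = 2 then 𝓛_{1/2}(u) = -1")] -/
theorem linnikFn_two_eq_neg_one {c : ℝ} (u : Fin 2 → ℝ) (h0 : u 0 < c) (h1 : u 1 < c)
    (hs : c ≤ u 0 + u 1) : linnikFn c u Finset.univ = -1 := by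
  have hN0 : smallFn c u {0} = 1 := smallFn_eq_one (Finset.singleton_nonempty 0) (by simpa using h0)
  have hN1 : smallFn c u {1} = 1 := smallFn_eq_one (Finset.singleton_nonempty 1) (by simpa using h1)
  have hNu : smallFn c u Finset.univ = 0 := smallFn_eq_zero (by simpa [Fin.sum_univ_two] using hs)
  have hNe : smallFn c u ∅ = 0 := smallFn_empty c u
  unfold linnikFn
  rw [Fintype.card_fin, show Finset.Icc 1 2 = {1, 2} from by decide, Finset.sum_pair (by norm_num)]
  rw [spow_succ, spow_zero, sconv_sdelta, spow_succ, spow_succ, spow_zero, sconv_sdelta,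
    sconv_univ_fin_two, hN0, hN1, hNu, hNe]
  simp only [wLinnik]
  norm_num

/-- **The weight of a two-piece fragmentation** in (6.3): for `u₀, u₁ < 1 - γ ≤ u₀ + u₁`,
`blockWeight γ 2 u = 𝓛_{1-γ}(u)/(2! u₀u₁) = -1/(2 u₀ u₁)`.
[cite: FordMaynard2024PrimeSieves, §6.1 (6.3) and §8] -/
theorem blockWeight_two_eq {γ : ℝ} (u : Fin 2 → ℝ) (h0 : u 0 < 1 - γ) (h1 : u 1 < 1 - γ)
    (hs : 1 - γ ≤ u 0 + u 1) : blockWeight γ 2 u = -1 / (2 * (u 0 * u 1)) := by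
  unfold blockWeight
  rw [linnikFn_two_eq_neg_one u h0 h1 hs, Fin.prod_univ_two, Nat.factorial_two]
  norm_num

end Summit.Parity.GeneralizedHardyLittlewood.FordMaynardNoSieveConst0164NegWitness0164

end
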